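import Summits.FinalStateConjecture.FinalStateConjecture.Theses.BondiDrainDispersal
import Summits.FinalStateConjecture.FinalStateConjecture.Theorems.BondiDrainDispersalHorizonlessMustDrainLogicTier
import Summits.FinalStateConjecture.FinalStateConjecture.Theorems.BondiDrainDispersalHorizonlessMustDrainTrappedHorizon
import Literature.Geometry.Lorentzian.PenroseSingularityTheorem
import Literature.Geometry.Lorentzian.ConformalScalarFlatCore
import HarnessLib

/-!
# Crux-strategist census s9 (independent, family `s`) — Lean certificate for
# `BondiDrainDispersal.HorizonlessMustDrain` (stmt-FinalStateConjecture-9976)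

Scratch certificate accompanying `STRATEGY-CENSUS-s9.md`.  Nothing here is a route item, a named fact
or a definition request; every `def` is a census PROPOSITION (a candidate weaker intermediate or a
candidate split piece), every theorem is sorry-free logic over the tree.

* §1 WEAKER INTERMEDIATE.  `HorizonlessMustDrainCK` = the crux restricted to data with a sole
  strongly asymptotically flat Christodoulou–Klainerman end (the only data on which `closes` consumes
  the crux).  Certified: `closes_of_ck` re-proves the route's deciding theorem from it (same two other
  cruxes), and `horizonlessMustDrainCK_of_crux` shows it is implied by the crux.  It is the FLOOR of the
  lens inside this thesis: `DrainImpliesDisperseCKH` accepts no mass input other than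
  `HasVanishingFinalBondiMass` of the given CK development.
* §2 DECOMPOSITIONS, typed, with sorry-free assemblies concluding the crux BY NAME:
  (B2) data-class split CK / rough; (B3) untrapped split (Penrose–Hawking–Ellis 9.2.1 piece +
  "untrapped censored horizonless ⇒ drain"); and the certificate that B3 has no teeth:
  `completeSector_of_untrapped` — the hard piece of B3 together with the PRINTED Penrose singularity
  theorem (named fact `Penrose1965_singularityTheorem`, hypothesis form) already implies the complete
  sector of the crux, which the tree records as the whole difficulty (`horizonlessMustDrain_iff_sectors`).
* §3 TRANSFER-SHAPED STRENGTHENING (Christodoulou 1987/1991 shape "M_f > 0 ⇒ trapped region"):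
  `NonDrainingTraps` (restricted to the horizonless censored sector) is implied by the crux outright
  (`nonDrainingTraps_of_crux`) and gives it back with the Penrose–HE piece (`crux_of_nonDrainingTraps`):
  a rewording, not a reduction.
-/

set_option linter.dupNamespace false

noncomputable section

open scoped Manifold ContDiff Topology
open Set Function Literature.Geometry.Lorentzian

namespace Summit.FinalStateConjecture.FinalStateConjecture.Cruxes.HorizonlessMustDrain.CensusS9

open Summit.FinalStateConjecture.FinalStateConjecture.Theses.BondiDrainDispersal
open Summit.FinalStateConjecture.FinalStateConjecture.Theorems.BondiDrainDispersalHorizonlessMustDrain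

/-! ## §1 The weaker intermediate W1 = the crux on CK data -/

/-- W1: `HorizonlessMustDrain` restricted to admissible data with a sole strongly asymptotically flat
CK end (binders of `CensoredHorizonlessDisperseCK` verbatim, conclusion of the crux verbatim). -/
def HorizonlessMustDrainCK : Prop :=
  ∀ (X : Type) [TopologicalSpace X] [ChartedSpace E3 X] [IsManifold (𝓡 3) ∞ X] [T2Space X]
    [SecondCountableTopology X] [ConnectedSpace X],
    ∀ D ∈ admissibleVacuumData X,
      (∃ (e : AFEnd X) (M : ℝ), e.IsSoleEnd ∧ e.IsStronglyAsymptoticallyFlatCK D M) →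
      ∀ 𝒟 : VacuumCauchyDevelopment D, 𝒟.IsMaximal →
        Summit.FinalStateConjecture.HasCompleteNullInfinity 𝒟.toCauchyDevelopment →
        ¬ (∀ [𝒟.metric.HasLeviCivita], ∃ q : 𝒟.carrier, ∀ (p : X) (γ : ℝ → 𝒟.carrier) (dom : Set ℝ),
            𝒟.metric.IsNormalisedNullRayFrom 𝒟.timeOrientation 𝒟.embed 𝒟.normal p γ dom → ¬ BddAbove dom →
              q ∉ 𝒟.metric.chronologicalPast 𝒟.timeOrientation (γ '' (dom ∩ Set.Ici 0))) →
        𝒟.toCauchyDevelopment.HasVanishingFinalBondiMass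

/-- The crux implies W1 (forget the CK clause). -/
theorem horizonlessMustDrainCK_of_crux (h : HorizonlessMustDrain) : HorizonlessMustDrainCK :=
  fun X _ _ _ _ _ _ D hD _ 𝒟 h𝒟 hI hH ↦ h X D hD 𝒟 h𝒟 hI hH

/-- W1 and the rank-2 crux compose to the rank-3 composite crux (the `have hA` of `closes`, with the CK
clause now passed to the mass input as well). -/
theorem censoredHorizonlessDisperseCK_of_ck (hM : HorizonlessMustDrainCK) (hΔ : DrainImpliesDisperseCKH) :
    CensoredHorizonlessDisperseCK := by
  intro X _ _ _ _ _ _ D hD hCK 𝒟 h𝒟 hI hH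
  exact hΔ X D hD hCK 𝒟 h𝒟 hI hH (hM X D hD hCK 𝒟 h𝒟 hI hH)

/-- **Certificate of the weaker intermediate**: the route's deciding theorem re-proved with W1 in place
of the crux (the rest of the proof is `closes` verbatim).  So the ∀-DR-data strength of
`HorizonlessMustDrain` is idle in this route: `closes` only ever consumes it on CK data. -/
theorem closes_of_ck (hM : HorizonlessMustDrainCK) (hΔ : DrainImpliesDisperseCKH)
    (hG : GenericCensoredHolesOrRoughSettle) : _root_.FinalStateConjecture := by
  have hA : CensoredHorizonlessDisperseCK := censoredHorizonlessDisperseCK_of_ck hM hΔ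
  intro X _ _ _ _ _ _ D hD
  have key : ∀ D' ∈ Literature.Geometry.Lorentzian.admissibleVacuumData X,
      ((∃ 𝒟 : Literature.Geometry.Lorentzian.VacuumCauchyDevelopment D', 𝒟.IsMaximal) ∧
        ∀ 𝒟 : Literature.Geometry.Lorentzian.VacuumCauchyDevelopment D', 𝒟.IsMaximal →
          Summit.FinalStateConjecture.HasCompleteNullInfinity 𝒟.toCauchyDevelopment ∧
          (((∀ [𝒟.metric.HasLeviCivita], ∃ q : 𝒟.carrier, ∀ (p : X) (γ : ℝ → 𝒟.carrier) (dom : Set ℝ),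
              𝒟.metric.IsNormalisedNullRayFrom 𝒟.timeOrientation 𝒟.embed 𝒟.normal p γ dom →
              ¬ BddAbove dom → q ∉ 𝒟.metric.chronologicalPast 𝒟.timeOrientation (γ '' (dom ∩ Set.Ici 0))) ∨
            ¬ (∃ (e : Literature.Geometry.Lorentzian.AFEnd X) (M : ℝ),
                e.IsSoleEnd ∧ e.IsStronglyAsymptoticallyFlatCK D' M)) →
            ∃ (O : Set 𝒟.carrier) (d : Literature.Geometry.Lorentzian.FinalStateDecomposition 𝒟.toSpacetime O 2),
              (∀ i, Literature.Geometry.Lorentzian.Kerr.IsSubextremal (d.mass i) (d.spin i)) ∧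
              O = Summit.FinalStateConjecture.exteriorOf 𝒟.toCauchyDevelopment d.charted ∧
              Summit.FinalStateConjecture.RaysStayInClosure 𝒟.toCauchyDevelopment O ∧
              Summit.FinalStateConjecture.HasExhaustiveCharts d ∧
              Summit.FinalStateConjecture.IsFutureOriented d)) →
      ((∃ 𝒟 : Literature.Geometry.Lorentzian.VacuumCauchyDevelopment D', 𝒟.IsMaximal) ∧
        ∀ 𝒟 : Literature.Geometry.Lorentzian.VacuumCauchyDevelopment D', 𝒟.IsMaximal →
          Summit.FinalStateConjecture.HasCompleteNullInfinity 𝒟.toCauchyDevelopment ∧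
            ∃ (O : Set 𝒟.carrier) (d : Literature.Geometry.Lorentzian.FinalStateDecomposition 𝒟.toSpacetime O 2),
              (∀ i, Literature.Geometry.Lorentzian.Kerr.IsSubextremal (d.mass i) (d.spin i)) ∧
              O = Summit.FinalStateConjecture.exteriorOf 𝒟.toCauchyDevelopment d.charted ∧
              Summit.FinalStateConjecture.RaysStayInClosure 𝒟.toCauchyDevelopment O ∧
              Summit.FinalStateConjecture.HasExhaustiveCharts d ∧
              Summit.FinalStateConjecture.IsFutureOriented d) := by
    intro D' hD' h
    refine ⟨h.1, fun 𝒟 h𝒟 ↦ ⟨(h.2 𝒟 h𝒟).1, ?_⟩⟩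
    by_cases hH : (∀ [𝒟.metric.HasLeviCivita], ∃ q : 𝒟.carrier, ∀ (p : X) (γ : ℝ → 𝒟.carrier) (dom : Set ℝ),
        𝒟.metric.IsNormalisedNullRayFrom 𝒟.timeOrientation 𝒟.embed 𝒟.normal p γ dom →
        ¬ BddAbove dom → q ∉ 𝒟.metric.chronologicalPast 𝒟.timeOrientation (γ '' (dom ∩ Set.Ici 0)))
    · exact (h.2 𝒟 h𝒟).2 (Or.inl hH)
    · by_cases hCK : ∃ (e : Literature.Geometry.Lorentzian.AFEnd X) (M : ℝ),
          e.IsSoleEnd ∧ e.IsStronglyAsymptoticallyFlatCK D' M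
      · obtain ⟨O, d, hN, hO, hR, hE, hF⟩ := hA X D' hD' hCK 𝒟 h𝒟 (h.2 𝒟 h𝒟).1 hH
        exact ⟨O, d, fun i ↦ (Fin.cast hN i).elim0, hO, hR, hE, hF⟩
      · exact (h.2 𝒟 h𝒟).2 (Or.inr hCK)
  obtain ⟨e, F, hT, hImm, h0, hinj, hF𝓓, hE⟩ := hG X D ⟨hD.1, fun h ↦ hD.2 (key D hD.1 h)⟩
  exact ⟨e, F, hT, hImm, h0, hinj, hF𝓓, fun c hc hmem ↦ hE c hc ⟨hmem.1, fun h ↦ hmem.2 (key _ hmem.1 h)⟩⟩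

/-! Audit: W1 decides the Statement with the route's two other cruxes, exactly as the crux does. -/
example := (closes_of_ck : HorizonlessMustDrainCK → DrainImpliesDisperseCKH → GenericCensoredHolesOrRoughSettle →
  _root_.FinalStateConjecture)
example := (closes : HorizonlessMustDrain → DrainImpliesDisperseCKH → GenericCensoredHolesOrRoughSettle →
  _root_.FinalStateConjecture)

/-! ## §2 Decompositions (typed, assemblies proved, concluding the crux by name) -/

/-- B2, rough piece: the crux on admissible data WITHOUT a sole CK end (the Dafermos–Rodnianski class
minus the Christodoulou–Klainerman class). -/
def HorizonlessMustDrainRough : Prop :=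
  ∀ (X : Type) [TopologicalSpace X] [ChartedSpace E3 X] [IsManifold (𝓡 3) ∞ X] [T2Space X]
    [SecondCountableTopology X] [ConnectedSpace X],
    ∀ D ∈ admissibleVacuumData X,
      ¬ (∃ (e : AFEnd X) (M : ℝ), e.IsSoleEnd ∧ e.IsStronglyAsymptoticallyFlatCK D M) →
      ∀ 𝒟 : VacuumCauchyDevelopment D, 𝒟.IsMaximal →
        Summit.FinalStateConjecture.HasCompleteNullInfinity 𝒟.toCauchyDevelopment →
        ¬ (∀ [𝒟.metric.HasLeviCivita], ∃ q : 𝒟.carrier, ∀ (p : X) (γ : ℝ → 𝒟.carrier) (dom : Set ℝ),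
            𝒟.metric.IsNormalisedNullRayFrom 𝒟.timeOrientation 𝒟.embed 𝒟.normal p γ dom → ¬ BddAbove dom →
              q ∉ 𝒟.metric.chronologicalPast 𝒟.timeOrientation (γ '' (dom ∩ Set.Ici 0))) →
        𝒟.toCauchyDevelopment.HasVanishingFinalBondiMass

/-- B2 assembly (trivial seam: excluded middle on the CK clause). -/
theorem HorizonlessMustDrain_of_dataClass :
    HorizonlessMustDrainCK → HorizonlessMustDrainRough → HorizonlessMustDrain := by
  intro hCK hR X _ _ _ _ _ _ D hD 𝒟 h𝒟 hI hH
  by_cases h : ∃ (e : AFEnd X) (M : ℝ), e.IsSoleEnd ∧ e.IsStronglyAsymptoticallyFlatCK D M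
  · exact hCK X D hD h 𝒟 h𝒟 hI hH
  · exact hR X D hD h 𝒟 h𝒟 hI hH

/-- B2 is exact: the crux is equivalent to the conjunction of its two data-class pieces. -/
theorem horizonlessMustDrain_iff_dataClass :
    HorizonlessMustDrain ↔ HorizonlessMustDrainCK ∧ HorizonlessMustDrainRough :=
  ⟨fun h ↦ ⟨horizonlessMustDrainCK_of_crux h, fun X _ _ _ _ _ _ D hD _ 𝒟 h𝒟 hI hH ↦ h X D hD 𝒟 h𝒟 hI hH⟩,
    fun h ↦ HorizonlessMustDrain_of_dataClass h.1 h.2⟩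

/-- B3, piece 1 (Penrose 1965 / Hawking–Ellis Prop. 9.2.1 in the summit's sojourn typing): a censored,
horizonless MGHD of an admissible datum contains NO closed trapped sphere to the causal future of the
data (trapped-surface clause typed verbatim as in `TrappedImpliesMassive`, stmt-FinalStateConjecture-11720). -/
def HorizonlessUntrapped : Prop :=
  ∀ (X : Type) [TopologicalSpace X] [ChartedSpace E3 X] [IsManifold (𝓡 3) ∞ X] [T2Space X]
    [SecondCountableTopology X] [ConnectedSpace X],
    ∀ D ∈ admissibleVacuumData X, ∀ 𝒟 : VacuumCauchyDevelopment D, 𝒟.IsMaximal →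
      Summit.FinalStateConjecture.HasCompleteNullInfinity 𝒟.toCauchyDevelopment →
      ¬ (∀ [𝒟.metric.HasLeviCivita], ∃ q : 𝒟.carrier, ∀ (p : X) (γ : ℝ → 𝒟.carrier) (dom : Set ℝ),
          𝒟.metric.IsNormalisedNullRayFrom 𝒟.timeOrientation 𝒟.embed 𝒟.normal p γ dom → ¬ BddAbove dom →
            q ∉ 𝒟.metric.chronologicalPast 𝒟.timeOrientation (γ '' (dom ∩ Set.Ici 0))) →
      ¬ (∀ [𝒟.metric.HasLeviCivita], ∃ f : Metric.sphere (0 : E3) 1 → 𝒟.carrier,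
          Set.range f ⊆ 𝒟.metric.causalFuture 𝒟.timeOrientation (Set.range 𝒟.embed) ∧
            𝒟.metric.IsTrappedSurface (𝓡 2) 𝒟.timeOrientation f)

/-- B3, piece 2: the crux weakened by the extra hypothesis "no closed trapped sphere to the causal future
of the data". -/
def UntrappedHorizonlessMustDrain : Prop :=
  ∀ (X : Type) [TopologicalSpace X] [ChartedSpace E3 X] [IsManifold (𝓡 3) ∞ X] [T2Space X]
    [SecondCountableTopology X] [ConnectedSpace X],
    ∀ D ∈ admissibleVacuumData X, ∀ 𝒟 : VacuumCauchyDevelopment D, 𝒟.IsMaximal →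
      Summit.FinalStateConjecture.HasCompleteNullInfinity 𝒟.toCauchyDevelopment →
      ¬ (∀ [𝒟.metric.HasLeviCivita], ∃ q : 𝒟.carrier, ∀ (p : X) (γ : ℝ → 𝒟.carrier) (dom : Set ℝ),
          𝒟.metric.IsNormalisedNullRayFrom 𝒟.timeOrientation 𝒟.embed 𝒟.normal p γ dom → ¬ BddAbove dom →
            q ∉ 𝒟.metric.chronologicalPast 𝒟.timeOrientation (γ '' (dom ∩ Set.Ici 0))) →
      ¬ (∀ [𝒟.metric.HasLeviCivita], ∃ f : Metric.sphere (0 : E3) 1 → 𝒟.carrier,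
          Set.range f ⊆ 𝒟.metric.causalFuture 𝒟.timeOrientation (Set.range 𝒟.embed) ∧
            𝒟.metric.IsTrappedSurface (𝓡 2) 𝒟.timeOrientation f) →
      𝒟.toCauchyDevelopment.HasVanishingFinalBondiMass

/-- B3 assembly (trivial seam). -/
theorem HorizonlessMustDrain_of_untrapped :
    HorizonlessUntrapped → UntrappedHorizonlessMustDrain → HorizonlessMustDrain :=
  fun hU hM X _ _ _ _ _ _ D hD 𝒟 h𝒟 hI hH ↦ hM X D hD 𝒟 h𝒟 hI hH (hU X D hD 𝒟 h𝒟 hI hH)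

/-- The crux gives back B3's second piece (forget the untrapped hypothesis). -/
theorem untrappedHorizonlessMustDrain_of_crux (h : HorizonlessMustDrain) : UntrappedHorizonlessMustDrain :=
  fun X _ _ _ _ _ _ D hD 𝒟 h𝒟 hI hH _ ↦ h X D hD 𝒟 h𝒟 hI hH

/-- On a Cauchy development of an admissible datum the data hypersurface `ι(X)` is not compact (the datum
has an asymptotically flat end, `AFEnd.not_isCompact_univ`, and `ι` is an embedding). -/
theorem not_isCompact_range_embed {X : Type} [TopologicalSpace X] [ChartedSpace E3 X] [IsManifold (𝓡 3) ∞ X]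
    [T2Space X] [SecondCountableTopology X] [ConnectedSpace X]
    {D : InitialDataSet (𝓡 3) X} (hD : D ∈ admissibleVacuumData X) (𝒟 : CauchyDevelopment D) :
    ¬ IsCompact (Set.range 𝒟.embed) := by
  obtain ⟨e, -, -, -⟩ := hD.2
  intro hc
  apply e.not_isCompact_univ
  have himg : IsCompact (𝒟.embed '' Set.univ) := by simpa [Set.image_univ] using hc
  exact (𝒟.isSmoothEmbedding.isEmbedding.isInducing.isCompact_iff).2 himg

/-- **B3 has no teeth — its hard piece contains the complete sector.**  With the printed Penrose
singularity theorem (named fact, hypothesis form) a future causally geodesically complete vacuum MGHD of an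
admissible datum contains no closed trapped sphere at all, and by W3/W6 (tree theorems) it has complete
`𝓘⁺` and no event horizon; so `UntrappedHorizonlessMustDrain` already yields the COMPLETE SECTOR of the
crux — the half the tree records as the whole difficulty (`horizonlessMustDrain_iff_sectors`). -/
theorem completeSector_of_untrapped (hP : Penrose1965_singularityTheorem.{0})
    (hM : UntrappedHorizonlessMustDrain) :
    (∀ (X : Type) [TopologicalSpace X] [ChartedSpace E3 X] [IsManifold (𝓡 3) ∞ X] [T2Space X]
      [SecondCountableTopology X] [ConnectedSpace X],
      ∀ D ∈ admissibleVacuumData X, ∀ 𝒟 : VacuumCauchyDevelopment D, 𝒟.IsMaximal →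
        (∀ [𝒟.metric.HasLeviCivita], ¬ 𝒟.metric.IsFutureNullGeodesicallyIncomplete 𝒟.timeOrientation ∧
          ¬ 𝒟.metric.IsFutureTimelikeGeodesicallyIncomplete 𝒟.timeOrientation) →
        𝒟.toCauchyDevelopment.HasVanishingFinalBondiMass) := by
  intro X _ _ _ _ _ _ D hD 𝒟 hmax hcomplete
  refine hM X D hD 𝒟 hmax
    (stub_scriComplete_of_futureNullComplete X D 𝒟.toCauchyDevelopment fun {_} ↦ hcomplete.1)
    (stub_noHorizon_of_futureNullComplete X D 𝒟.toCauchyDevelopment fun {_} ↦ hcomplete.1) ?_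
  intro htrap
  haveI : 𝒟.metric.HasLeviCivita := 𝒟.metric.toPseudoRiemannianMetric.hasLeviCivita
  haveI : Nonempty (Metric.sphere (0 : E3) 1) := (NormedSpace.sphere_nonempty.mpr zero_le_one).to_subtype
  obtain ⟨f, -, hf⟩ := htrap
  exact hcomplete.1 (hP 𝒟.toSpacetime 𝒟.toCauchyDevelopment.isGloballyHyperbolic (Set.range 𝒟.embed)
    𝒟.isCauchyHypersurface (not_isCompact_range_embed hD 𝒟.toCauchyDevelopment)
    (LorentzianMetric.satisfiesNullConvergence_of_isRicciFlat 𝒟.isRicciFlat) f hf)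

/-! ## §3 The transfer-shaped strengthening (Christodoulou 1987/1991: `M_f > 0 ⇒` trapped region) -/

/-- C⁺ (restricted to the censored horizonless sector, the only form the crux can use): a censored,
horizonless MGHD of an admissible datum whose final Bondi mass does NOT vanish contains a closed trapped
sphere to the causal future of the data. -/
def NonDrainingTraps : Prop :=
  ∀ (X : Type) [TopologicalSpace X] [ChartedSpace E3 X] [IsManifold (𝓡 3) ∞ X] [T2Space X]
    [SecondCountableTopology X] [ConnectedSpace X],
    ∀ D ∈ admissibleVacuumData X, ∀ 𝒟 : VacuumCauchyDevelopment D, 𝒟.IsMaximal →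
      Summit.FinalStateConjecture.HasCompleteNullInfinity 𝒟.toCauchyDevelopment →
      ¬ (∀ [𝒟.metric.HasLeviCivita], ∃ q : 𝒟.carrier, ∀ (p : X) (γ : ℝ → 𝒟.carrier) (dom : Set ℝ),
          𝒟.metric.IsNormalisedNullRayFrom 𝒟.timeOrientation 𝒟.embed 𝒟.normal p γ dom → ¬ BddAbove dom →
            q ∉ 𝒟.metric.chronologicalPast 𝒟.timeOrientation (γ '' (dom ∩ Set.Ici 0))) →
      ¬ 𝒟.toCauchyDevelopment.HasVanishingFinalBondiMass →
      ∀ [𝒟.metric.HasLeviCivita], ∃ f : Metric.sphere (0 : E3) 1 → 𝒟.carrier,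
          Set.range f ⊆ 𝒟.metric.causalFuture 𝒟.timeOrientation (Set.range 𝒟.embed) ∧
            𝒟.metric.IsTrappedSurface (𝓡 2) 𝒟.timeOrientation f

/-- The crux implies C⁺ outright (its hypothesis `¬ drain` is contradicted): C⁺ is not a strengthening with
content of its own in the sector where the route could use it. -/
theorem nonDrainingTraps_of_crux (h : HorizonlessMustDrain) : NonDrainingTraps :=
  fun X _ _ _ _ _ _ D hD 𝒟 h𝒟 hI hH hnd ↦ absurd (h X D hD 𝒟 h𝒟 hI hH) hnd

/-- … and C⁺ gives the crux back with the Penrose–Hawking–Ellis piece of B3: modulo `HorizonlessUntrapped`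
the "transfer" is a rewording of the crux. -/
theorem crux_of_nonDrainingTraps (hU : HorizonlessUntrapped) (hT : NonDrainingTraps) : HorizonlessMustDrain := by
  intro X _ _ _ _ _ _ D hD 𝒟 h𝒟 hI hH
  by_contra hnd
  exact hU X D hD 𝒟 h𝒟 hI hH (fun {_} ↦ hT X D hD 𝒟 h𝒟 hI hH hnd)

/-! Audit block: every assembly concludes the route decl by name. -/
example := (HorizonlessMustDrain_of_dataClass : _ → _ →
  Summit.FinalStateConjecture.FinalStateConjecture.Theses.BondiDrainDispersal.HorizonlessMustDrain)
example := (HorizonlessMustDrain_of_untrapped : _ → _ →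
  Summit.FinalStateConjecture.FinalStateConjecture.Theses.BondiDrainDispersal.HorizonlessMustDrain)
example := (crux_of_nonDrainingTraps : _ → _ →
  Summit.FinalStateConjecture.FinalStateConjecture.Theses.BondiDrainDispersal.HorizonlessMustDrain)

end Summit.FinalStateConjecture.FinalStateConjecture.Cruxes.HorizonlessMustDrain.CensusS9

end
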